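import Summits.QuantumFields.YangMills.Theorems.BalabanUVNodesN15KingModelGraphPowerCountingComponents

/-!
# BalabanUVNodes ∕ N15 — THE KING-MODEL RUNG (PART Δ-j): **KING's SUBGRAPH CONDITION FOR `G`∕`∂G` GRAPHS IS DECIDABLE** — for exponents `2 − (d+1)`, `1 − (d+1)` and
# `1 ≤ d`, «every subgraph has positive degree» (part Δ-a's `PosSubgraphsBy … 0`) is EQUIVALENT to the integer certificate `∀ S ≠ ∅, (d−1)|S| + #∂G(S) + d + 2 ≤
# (d+1)|V(S)|`, and «non-negative degree» to its non-strict twin; so for an explicit graph both King sentences are settled by `decide` — worked on K₄ in four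
# dimensions: NOT positive (degree `4·3 − 2·6 = 0`), but non-negative, hence bounded by `const·(k+1)⁶` (part Λ-b)
# (Track A, DAG node N15 = NE2; FAN-OUT v1.1 §N15 s3 «KING-MODEL RUNG … NE2's analogue DECIDED in the model»)

HONEST FRAMING.  Count-neutral (cell `pub-ymgap`, seat `pub-ymgap-dag-n15-e` g28; `--supports stmt-QuantumFields-27366 --as helper` = K3⁸
`SpineGivenEndpointR13SepCoPHV`).  TEMPLATE LITERATURE: C. King, *The U(1) Higgs model. I. The continuum limit*, Commun. Math. Phys. **102** (1986) 649–677
[King1986], §3.4 p. 664, §3.5 p. 666, Prop. 3.7 (3.63) p. 663.  Part Δ-h gave the integer certificates as SUFFICIENT conditions; part Δ-i showed the «connected»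
qualifier inessential (`dV ≥ 0`).  THIS FILE closes the loop: by integrality of King's exponents the certificates are also NECESSARY, so the subgraph condition
is a decidable property of the numbered graph and its `∂`-pattern; `decide` then both PROVES and REFUTES it on explicit graphs.  King's U(1)∕`A = 0` model
bookkeeping; NOT Bałaban's `G(U)`; NOT a node discharge; nothing continuum ∕ ℝ⁴ ∕ OS ∕ mass-gap ∕ Clay.  0 `sorry`; standard axioms; `decide` on a 6-line graph.
THE PRINT.  p. 664 [PDF 16]: *«it is necessary that every subgraph have positive degree D. Some of the subgraphs H_i may be divergent.»*
WHAT THIS FILE PROVES.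
* §1 (ns `…Curved`) ★★ **`posSubgraphsBy_lineExp_iff_cert`** (`1 ≤ d`: `PosSubgraphsBy src tgt 0 (d+1) (lineExp ∘ κ) ↔ ∀ S ≠ ∅, (d−1)|S| + #∂G(S) + d + 2 ≤ (d+1)|V(S)|`),
  ★★ **`nonnegSubgraphs_lineExp_iff_cert`** (`NonnegSubgraphs … ↔ ∀ S ≠ ∅, (d−1)|S| + #∂G(S) + d + 1 ≤ (d+1)|V(S)|`).
* §2 (ns `…Graph` data ∕ `…Curved` theorems) `k4Src`∕`k4Tgt` (K₄: lines `01, 02, 03, 12, 13, 23`), `lConn_k4`, `not_cert_k4_three`, `nonnegCert_k4_three` (by `decide`),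
  ★ **`not_posSubgraphsBy_k4_four`** (K₄ with `G`-lines in `d + 1 = 4` VIOLATES King's condition — decided), ★★ **`king_graph_size_log_k4_four`** (but its subgraph
  degrees are all `≥ 0`, so `|E^{(k)}(K₄)| ≤ Γ·C₁⁶·C₂³·(6!·(k+1)⁶)·Π q`).
HONEST SCOPE.  Decidability of the COMBINATORIAL condition only; which graphs King's expansion produces and how §3.5 renormalises the non-positive ones ([Ba3]) is
not touched; upper bounds only.  Locators: [King1986] p.664, p.666, (3.63) p.663.
-/
noncomputable section

namespace Summit.QuantumFields.YangMills.BalabanUVNodes.N15KingModelRung.Graph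

open scoped BigOperators
open Finset
open Summit.QuantumFields.YangMills.BalabanUVNodes.N15KingModelRung.Curved (dLines)

/-! ## §2 (data) K₄ -/

section K4

/-- K₄ on the vertices `0, 1, 2, 3`: lines `01, 02, 03, 12, 13, 23` (three independent loops). [cite: King1986, p.664] -/
def k4Src : Fin 6 → Fin 4 := ![0, 0, 0, 1, 1, 2]

/-- the targets of K₄. [cite: King1986, p.664] -/
def k4Tgt : Fin 6 → Fin 4 := ![1, 2, 3, 2, 3, 3]

/-- K₄ is connected to its external vertex. [folklore] -/
theorem lConn_k4 : ∀ v : Fin 4, LConn k4Src k4Tgt univ 0 v := by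
  intro v
  fin_cases v
  · exact Relation.EqvGen.refl _
  · exact Relation.EqvGen.rel _ _ ⟨0, mem_univ _, rfl, rfl⟩
  · exact Relation.EqvGen.rel _ _ ⟨1, mem_univ _, rfl, rfl⟩
  · exact Relation.EqvGen.rel _ _ ⟨2, mem_univ _, rfl, rfl⟩

/-- **K₄ FAILS THE STRICT CERTIFICATE IN FOUR DIMENSIONS** (`d = 3`, `G`-lines: the whole graph has `2·6 + 0 + 5 = 17 > 16 = 4·4`), by `decide`. [cite: King1986, p.664] -/
theorem not_cert_k4_three :
    ¬ ∀ S : Finset (Fin 6), S.Nonempty →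
        (3 - 1) * S.card + dLines (fun _ : Fin 6 => (none : Option (Fin (3 + 1)))) S + 3 + 2 ≤ (3 + 1) * (lineVerts k4Src k4Tgt S).card := by
  decide

/-- **K₄ PASSES THE NON-STRICT CERTIFICATE IN FOUR DIMENSIONS** (`2|S| + 4 ≤ 4|V(S)|` for all 63 non-empty line sets; equality for the whole graph), by `decide`.
[cite: King1986, p.664] -/
theorem nonnegCert_k4_three :
    ∀ S : Finset (Fin 6), S.Nonempty →
      (3 - 1) * S.card + dLines (fun _ : Fin 6 => (none : Option (Fin (3 + 1)))) S + 3 + 1 ≤ (3 + 1) * (lineVerts k4Src k4Tgt S).card := by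
  decide

end K4

end Summit.QuantumFields.YangMills.BalabanUVNodes.N15KingModelRung.Graph

namespace Summit.QuantumFields.YangMills.BalabanUVNodes.N15KingModelRung.Curved

open scoped BigOperators
open Finset
open Literature.MathematicalPhysics.QuantumFieldTheory.Balaban1983to89.B5Prop11Plancherel (Tor fine unitVec)
open Summit.QuantumFields.YangMills.BalabanUVNodes.N15KingModelRung.Graph

variable (L : ℕ)

/-! ## §1 The certificates are exact -/

section Exact
variable {nn m : ℕ} {src tgt : Fin m → Fin (nn + 1)}

omit L in
/-- ★★ **KING's SUBGRAPH CONDITION IS THE STRICT INTEGER CERTIFICATE** (`1 ≤ d`, lines `G`∕`∂G`): `PosSubgraphsBy src tgt 0 (d+1) (lineExp ∘ κ)` holds iff every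
non-empty line set has `(d−1)·|S| + #∂G(S) + d + 2 ≤ (d+1)·|V(S)|` — part Δ-h (⇐), part Δ-i's all-sets form and integrality (⇒). [cite: King1986, p.664] -/
theorem posSubgraphsBy_lineExp_iff_cert {d : ℕ} (hd1 : 1 ≤ d) (κ : Fin m → Option (Fin (d + 1))) :
    PosSubgraphsBy src tgt 0 ((d + 1 : ℕ) : ℝ) (fun ℓ => lineExp (d + 1) (κ ℓ))
      ↔ ∀ S : Finset (Fin m), S.Nonempty → (d - 1) * S.card + dLines κ S + d + 2 ≤ (d + 1) * (lineVerts src tgt S).card := by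
  refine ⟨fun h S hS => ?_, posSubgraphsBy_lineExp_of_cert hd1⟩
  have hlt := lt_subDeg_of_posSubgraphsBy le_rfl (by positivity) h S hS
  rw [subDeg_lineExp_eq_card] at hlt
  have hcast : (((d - 1 : ℕ) : ℝ)) = (d : ℝ) - 1 := by rw [Nat.cast_sub hd1, Nat.cast_one]
  have key : (d - 1) * S.card + dLines κ S + d + 1 < (d + 1) * (lineVerts src tgt S).card := by
    have h' : (((d - 1 : ℕ) : ℝ)) * (S.card : ℝ) + (dLines κ S : ℝ) + d + 1 < ((d + 1 : ℕ) : ℝ) * ((lineVerts src tgt S).card : ℝ) := by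
      rw [hcast]; push_cast at hlt ⊢; nlinarith
    exact_mod_cast h'
  omega

omit L in
/-- ★★ **THE NON-NEGATIVE CONDITION IS THE NON-STRICT CERTIFICATE** (`1 ≤ d`): `NonnegSubgraphs src tgt (d+1) (lineExp ∘ κ)` iff every non-empty line set has
`(d−1)·|S| + #∂G(S) + d + 1 ≤ (d+1)·|V(S)|`. [cite: King1986, p.664, (3.78) p.666] -/
theorem nonnegSubgraphs_lineExp_iff_cert {d : ℕ} (hd1 : 1 ≤ d) (κ : Fin m → Option (Fin (d + 1))) :
    NonnegSubgraphs src tgt ((d + 1 : ℕ) : ℝ) (fun ℓ => lineExp (d + 1) (κ ℓ))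
      ↔ ∀ S : Finset (Fin m), S.Nonempty → (d - 1) * S.card + dLines κ S + d + 1 ≤ (d + 1) * (lineVerts src tgt S).card := by
  refine ⟨fun h S hS => ?_, nonnegSubgraphs_lineExp_of_cert hd1⟩
  have hle := subDeg_nonneg_of_nonnegSubgraphs (by positivity) h S hS
  rw [subDeg_lineExp_eq_card] at hle
  have hcast : (((d - 1 : ℕ) : ℝ)) = (d : ℝ) - 1 := by rw [Nat.cast_sub hd1, Nat.cast_one]
  have h' : (((d - 1 : ℕ) : ℝ)) * (S.card : ℝ) + (dLines κ S : ℝ) + d + 1 ≤ ((d + 1 : ℕ) : ℝ) * ((lineVerts src tgt S).card : ℝ) := by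
    rw [hcast]; push_cast at hle ⊢; nlinarith
  exact_mod_cast h'

end Exact

/-! ## §2 K₄ in four dimensions: not positive, but non-negative — bounded by `const·(k+1)⁶` -/

section K4
variable [NeZero L]

omit L in
/-- ★ **K₄ WITH `G`-LINES IN FOUR DIMENSIONS VIOLATES KING's SUBGRAPH CONDITION** (degree `4·3 − 2·6 = 0`), by §1 and `decide`. [cite: King1986, p.664] -/
theorem not_posSubgraphsBy_k4_four :
    ¬ PosSubgraphsBy k4Src k4Tgt 0 ((3 + 1 : ℕ) : ℝ) (fun ℓ => lineExp (3 + 1) ((fun _ : Fin 6 => (none : Option (Fin (3 + 1)))) ℓ)) := by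
  rw [posSubgraphsBy_lineExp_iff_cert (by norm_num)]
  exact not_cert_k4_three

/-- ★★ **K₄ IN FOUR DIMENSIONS IS BOUNDED BY `const·(k+1)⁶`** (`d = 3`): all its subgraph degrees are `≥ 0` (§1 + `decide`), so part Λ-b gives
`|E^{(k)}(K₄)| ≤ Γ·C₁⁶·C₂³·(6!·(k+1)⁶)·Π q`. [cite: King1986, p.666 («some power of ln(L^kε)^{−1}»)] -/
theorem king_graph_size_log_k4_four (hLodd : Odd L) (hL : 2 ≤ L) {a : ℝ} (ha : 0 < a) {m0sq : ℝ} (hm0 : 0 ≤ m0sq) :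
    ∃ C₁ C₂ : ℝ, 0 < C₁ ∧ 0 < C₂ ∧ ∀ (k eM : ℕ) (hk : 1 ≤ k) (M : Fin (3 + 1) → ℕ) [∀ μ, NeZero (M μ)] (hM : ∀ μ, M μ = 2 * L ^ eM)
      (msq : ℝ), 0 < msq → msq ≤ m0sq →
      ∀ (Υ : Type) [Fintype Υ] [DecidableEq Υ] (vtx : Υ → Fin (3 + 1)) (u : Υ → Tor (fine (L ^ k) M) → ℝ) (q : Υ → ℝ) (υ₀ : Υ) (Γ : ℝ),
        vtx υ₀ = 0 → (∀ υ, υ ≠ υ₀ → ∀ x, |u υ x| ≤ q υ) → (∑ x, (((L : ℝ) ^ k)⁻¹) ^ (3 + 1) * |u υ₀ x| ≤ Γ) →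
          |graphValLS ((((L : ℝ) ^ k)⁻¹) ^ (3 + 1)) k4Src k4Tgt (fun _ => kingGLine L M a msq k none) vtx u|
            ≤ Γ * (C₁ ^ 6 * C₂ ^ 3 * (((Nat.factorial 6 : ℕ) : ℝ) * ((k : ℝ) + 1) ^ 6) * ∏ υ ∈ univ.erase υ₀, q υ) := by
  obtain ⟨C₁, C₂, hC₁, hC₂, H⟩ := king_graph_size_log_zeroField_mixedCert (d := 3) L (by norm_num) hLodd hL ha hm0
  refine ⟨C₁, C₂, hC₁, hC₂, fun k eM hk M _ hM msq hm hcap Υ _ _ vtx u q υ₀ Γ hυ₀ hq hΓ => ?_⟩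
  exact H k eM hk M hM msq hm hcap 3 6 k4Src k4Tgt lConn_k4 (fun _ => none) nonnegCert_k4_three Υ vtx u q υ₀ Γ hυ₀ hq hΓ

end K4

end Summit.QuantumFields.YangMills.BalabanUVNodes.N15KingModelRung.Curved

end
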